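import Literature.AnabelianGeometry.EtaleTheta.FrobenioidCyclotomicRigidityProjGalois
import Literature.AnabelianGeometry.EtaleTheta.Discharge.Sec5ThetaSubquotientProjEmptyAtRootModel
import Literature.AnabelianGeometry.SemiGraphs.TemperoidsGaloisTorsorProofs
import HarnessLib

/-!
# [EtTh] §5 p.327: the v2 record `ThetaSubquotientProjGalois` (surjectivity at Galois objects only) is INHABITED at the genuine R2 carrier
# over `B^temp(Π)⁰` — in particular at abc-iut-L2-t1's ROOT MODEL, where the v1 record is EMPTY (proof-only)

S. Mochizuki, *The étale theta function and its Frobenioid-theoretic manifestations*, Publ. RIMS **45** (2009), §5 p. 327 (PDF p. 101):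
"these subquotients determine subquotients `Aut_D(D) ↠ Aut^Θ_D(D)`; `(l·Δ_Θ)_D ⊆ Aut^Θ_D(D)`" [cite: MochizukiEtTh2009, §5 p.327 (PDF p.101)];
[SemiAnbd] Def. 3.1 (iv) p. 33, Rmk. 3.1.3 p. 34 (Galois objects of `B^temp(Π)`: `Aut` acts transitively on points)
[cite: MochizukiSemiAnbd2006, Rmk 3.1.3 p.34].

abc-iut cell, layer L2, seat abc-iut-w6-d079 (gen 6), row «PROJ-SURJ-PLAN-A» (abc-iut-L2-lead gen 6 R847), file B = the «FIRST CHECK» of the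
row: the v2 record of `FrobenioidCyclotomicRigidityProjGalois.lean` is INHABITED where the v1 record is empty.  PROOF-ONLY (0 definitions);
abc-iut-L2-t9's `autPre` / `autProj` / `evalEquiv` / `thetaSubquotientStub` / `ofSetting` and abc-iut-L2-t1's `ThetaSetting.model`,
`toTheta_surjective` are consumed BY NAME; nothing landed is edited or restated.

WHAT IS PROVED.
* `ThetaSubquotient.autProj_surjective_at_galoisObj` — for `q : Π → Q` ONTO and a GALOIS object `E` of `B^temp(Π)` ([SemiAnbd] Def. 3.1
  (iv), the tree's `IsGaloisObj`), abc-iut-L2-t9's canonical homomorphism `autProj : autPre q ι E →* (l·Δ_Θ)_E` is SURJECTIVE — the statement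
  of abc-iut-w5-d013's `autProj_surjective_of_isGaloisObj` (`Sec5ThetaSubquotientAutLaws`, p429126) WITHOUT its `IsTempered Π` /
  `IsTopologicalGroup Π` hypotheses: the automorphism is supplied by `GaloisTorsor.exists_aut_apply_eq_of_isGaloisObj` (Aut-transitivity on
  points) instead of the normal stabiliser of a Galois base point.
* **`ThetaSubquotient.nonempty_thetaSubquotientProjGalois_of_stub_eq`** — for EVERY §5 datum `𝔉` over `B^temp(Π)⁰` with
  `𝔉.toThetaSubquotientStub = thetaSubquotientStub q ι` and `q` onto, the v2 record with the chain's Galois reading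
  `Gal E := IsGaloisObj E.obj` is inhabited: `pre E := autPre q ι E.obj` pulled back along `Aut_D(E) ≃ Aut(E.obj)` (full subcategory,
  `Functor.FullyFaithful.autMulEquivOfFullyFaithful`), `proj E := autProj ∘ (that)`.
* `…_ofSettingSub` / **`…_ofSetting`** — at print's `Q` over `B^temp(U)⁰` whenever `(Π^tp_X ↠ (Π^tp_X)^Θ)|_U` is onto, and over
  `B^temp(Π^tp_X)⁰` for EVERY `ThetaSetting` and every `l` (`toTheta_surjective`).
* **`SettingModel.nonempty_thetaSubquotientProjGalois_ofSetting_model`** and **`…isEmpty_proj_and_nonempty_projGalois_ofSetting_model`** — at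
  abc-iut-L2-t1's ROOT MODEL `ThetaSetting.model p`: for `l` odd the v1 record `ThetaSubquotientProj 𝔉` is EMPTY (abc-iut-L2-t9 p476337,
  `isEmpty_thetaSubquotientProj_ofSetting_model`, BY NAME) AND the v2 record is INHABITED — the very instance the row names.

HONEST FRAMING: a statement about the cell's OWN typed records at abc-iut-L2-t9's carrier; at NON-Galois objects the v2 record promises nothing
(there the carrier is the coinvariant enlargement, p456572); nothing of [EtTh] (refereed) is asserted; no side is taken on [IUTchIII] Cor. 3.12;
typed ≠ proved.
-/

noncomputable section

namespace Literature.AnabelianGeometry.EtaleTheta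

open CategoryTheory Literature.AlgebraicGeometry.Frobenioids Literature.AnabelianGeometry.SemiGraphs
open Literature.AlgebraicGeometry.Frobenioids.QuasiTemperoid (stabilizerSubgroup)
open Literature.AlgebraicGeometry.Frobenioids.QuasiTemperoid.BTempConnected (isConnectedObj_iff)
open FrobenioidCyclotomicRigidity (ThetaSubquotientProj ThetaSubquotientProjGalois)
open scoped IsMulCommutative

namespace ThetaSubquotient

universe u v w u₁ v₁

variable {G : Type u} [Group G] [TopologicalSpace G] {Q : Type v} [Group Q] {Λ : Type w} [CommGroup Λ]
  (q : G →* Q) (ι : Λ →* Q) [ι.range.Normal]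

/-! ### 1. `autProj` is onto at a Galois object -/

/-- **At a GALOIS object `autProj` is surjective**, for ANY topological group `Π` ([SemiAnbd] Def. 3.1 (iv): `Aut(E)` acts transitively
on the points of `E`, `GaloisTorsor.exists_aut_apply_eq_of_isGaloisObj`): for `q` onto, every class of `(l·Δ_Θ)_E ≅ Λ/J(Stab x)` is
`autProj σ` for the automorphism `σ` with `σ(x) = n·x`, `q(n) = ι(a)` — abc-iut-w5-d013's `autProj_surjective_of_isGaloisObj` (p429126)
minus its `IsTempered`/`IsTopologicalGroup` hypotheses. [cite: MochizukiEtTh2009, §5 p.327 (PDF p.101)] -/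
theorem autProj_surjective_at_galoisObj {E : BTemp G} (hE : IsGaloisObj E) (hq : Function.Surjective q) :
    Function.Surjective (autProj q ι E) := by
  have hEc : IsConnectedObj E := hE.1
  obtain ⟨⟨x⟩, -⟩ := (isConnectedObj_iff E).mp hEc
  intro c
  obtain ⟨c₀, rfl⟩ := (evalEquiv q ι hEc x).symm.surjective c
  induction c₀ using QuotientGroup.induction_on with
  | H a =>
    obtain ⟨n, hn⟩ := hq (ι a)
    obtain ⟨σ, hσ⟩ := GaloisTorsor.exists_aut_apply_eq_of_isGaloisObj E hE x (E.obj.ρ n x)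
    have hmem : σ ∈ autPre q ι E := mem_autPre_of_apply_eq q ι hEc x (hn ▸ mem_range_self ι a) hσ
    refine ⟨⟨σ, hmem⟩, ?_⟩
    apply (evalEquiv q ι hEc x).injective
    rw [MulEquiv.apply_symm_apply, evalEquiv_apply]
    exact evalAt_autProj q ι E ⟨σ, hmem⟩ x n a hn.symm hσ

/-! ### 2. The v2 record is inhabited at the R2 carrier -/

section Main

variable {C : Type u₁} [Category.{v₁} C]

/-- **INHABITATION of the v2 record at abc-iut-L2-t9's carrier**: for every §5 datum `𝔉` over `B^temp(Π)⁰` whose theta-subquotient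
stub is `thetaSubquotientStub q ι` with `q` onto, `ThetaSubquotientProjGalois 𝔉 (fun E => IsGaloisObj E.obj)` is inhabited —
`pre E :=` print's automorphisms "given by `l·Δ_Θ`" (`autPre`, pulled back along `Aut_D(E) ≃ Aut(E.obj)`), `proj E := autProj`, onto at
Galois objects by `autProj_surjective_at_galoisObj`. [cite: MochizukiEtTh2009, §5 p.327 (PDF p.101)] -/
theorem nonempty_thetaSubquotientProjGalois_of_stub_eq (hq : Function.Surjective q)
    (𝔉 : ThetaFrobenioid.{max u w} C (ConnectedPart (BTemp G)))
    (h𝔉 : 𝔉.toThetaSubquotientStub = thetaSubquotientStub q ι) :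
    Nonempty (ThetaSubquotientProjGalois 𝔉 fun E => IsGaloisObj E.obj) := by
  cases 𝔉 with
  | mk toTemperedFrobenioidStub toThetaSubquotientStub =>
    dsimp only at h𝔉
    subst h𝔉
    -- `Aut_D(E) ≃ Aut(E.obj)` along the full subcategory inclusion `B^temp(Π)⁰ ⥤ B^temp(Π)`
    let e : ∀ E : ConnectedPart (BTemp G), Aut E ≃* Aut E.obj := fun E =>
      (connectedObjects (BTemp G)).fullyFaithfulι.autMulEquivOfFullyFaithful E
    let pre : ∀ E : ConnectedPart (BTemp G), Subgroup (Aut E) := fun E => (autPre q ι E.obj).comap (e E).toMonoidHom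
    refine ⟨{ pre := pre
              proj := fun E => (autProj q ι E.obj).comp
                (((e E).toMonoidHom.restrict (pre E)).codRestrict (autPre q ι E.obj) fun σ => σ.2)
              proj_surjective := fun E hE c => ?_ }⟩
    obtain ⟨σ₀, hσ₀⟩ := autProj_surjective_at_galoisObj q ι hE hq c
    have hmem : (e E).symm σ₀.1 ∈ pre E := by
      change (e E) ((e E).symm σ₀.1) ∈ autPre q ι E.obj
      rw [MulEquiv.apply_symm_apply]
      exact σ₀.2
    refine ⟨⟨(e E).symm σ₀.1, hmem⟩, ?_⟩
    rw [← hσ₀]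
    change autProj q ι E.obj ⟨(e E) ((e E).symm σ₀.1), _⟩ = autProj q ι E.obj σ₀
    congr 1

end Main

/-! ### 3. The pinned data: print's `Q`, the single underline case, the root model -/

section Setting

variable {p : ℕ} [Fact p.Prime] (D : ThetaSetting p) (l : ℕ) (U : Subgroup D.PiTemp)
  {C : Type u₁} [Category.{v₁} C]

/-- **Print's `Q` over `B^temp(U)⁰`** (`ofSettingSub D l U`, the stub of abc-iut-L2-t4's junction object `ofThetaSettingDataQ`): whenever
`(Π^tp_X ↠ (Π^tp_X)^Θ)|_U` is onto (e.g. `U = Π^tp_X̲̲ ⊇ Δ`-part mapping onto `(Π^tp_X)^Θ`), the v2 record is inhabited for every §5 datum with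
that stub. [cite: MochizukiEtTh2009, §5 p.327 (PDF p.101)] -/
theorem nonempty_thetaSubquotientProjGalois_ofSettingSub (hq : Function.Surjective (qSub D U))
    (𝔉 : ThetaFrobenioid.{0} C (ConnectedPart (BTemp ↥U)))
    (h𝔉 : 𝔉.toThetaSubquotientStub = ofSettingSub D l U) :
    Nonempty (ThetaSubquotientProjGalois 𝔉 fun E => IsGaloisObj E.obj) :=
  nonempty_thetaSubquotientProjGalois_of_stub_eq (qSub D U) (ιTheta D l) hq 𝔉 (h𝔉.trans (ofSettingSub_eq D l U))

/-- **Single underline case "`A = X`"** (`ofSetting D l` over `B^temp(Π^tp_X)⁰`; `q = Π^tp_X ↠ (Π^tp_X)^Θ` is ONTO by the setting's field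
`toTheta_surjective`): for EVERY `ThetaSetting`, every `l` and every §5 datum `𝔉` with that stub, the v2 record is INHABITED.
[cite: MochizukiEtTh2009, §5 p.322 (PDF p.96)] -/
theorem nonempty_thetaSubquotientProjGalois_ofSetting
    (𝔉 : ThetaFrobenioid.{0} C (ConnectedPart (BTemp D.PiTemp)))
    (h𝔉 : 𝔉.toThetaSubquotientStub = ofSetting D l) :
    Nonempty (ThetaSubquotientProjGalois 𝔉 fun E => IsGaloisObj E.obj) :=
  nonempty_thetaSubquotientProjGalois_of_stub_eq D.toTheta (ιTheta D l) D.toTheta_surjective 𝔉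
    (h𝔉.trans (ofSetting_eq D l))

end Setting

end ThetaSubquotient

namespace SettingModel

open ThetaSubquotient

universe u₁ v₁

variable (p : ℕ) [Fact p.Prime]

/-- **At the ROOT MODEL** (abc-iut-L2-t1's `ThetaSetting.model p`, `Π^tp_X := F₂ × G_{ℚ_p}` discrete): for every `l` and every §5 datum
`𝔉` over `B^temp(Π^tp_X)⁰` with stub `ofSetting (model p) l`, the v2 record `ThetaSubquotientProjGalois 𝔉 (IsGaloisObj ·.obj)` is INHABITED.
[cite: MochizukiEtTh2009, §5 p.327 (PDF p.101)] -/
theorem nonempty_thetaSubquotientProjGalois_ofSetting_model (l : ℕ) {C : Type u₁} [CategoryTheory.Category.{v₁} C]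
    (𝔉 : ThetaFrobenioid.{0} C (ConnectedPart (BTemp (ThetaSetting.model p).PiTemp)))
    (h𝔉 : 𝔉.toThetaSubquotientStub = ThetaSubquotient.ofSetting (ThetaSetting.model p) l) :
    Nonempty (ThetaSubquotientProjGalois 𝔉 fun E => IsGaloisObj E.obj) :=
  nonempty_thetaSubquotientProjGalois_ofSetting (ThetaSetting.model p) l 𝔉 h𝔉

/-- **The contrast the row asked for, in one statement**: at the root model with `l` ODD, the frozen v1 record `ThetaSubquotientProj 𝔉`
(surjective at EVERY object) is EMPTY — abc-iut-L2-t9's certificate p476337 `isEmpty_thetaSubquotientProj_ofSetting_model` (a rigid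
non-Galois covering with non-trivial carrier) — while the v2 record (surjective at GALOIS objects) is INHABITED.
[cite: MochizukiEtTh2009, §5 p.327 (PDF p.101)] -/
theorem isEmpty_proj_and_nonempty_projGalois_ofSetting_model (l : ℕ) (hl : Odd l)
    {C : Type u₁} [CategoryTheory.Category.{v₁} C]
    (𝔉 : ThetaFrobenioid.{0} C (ConnectedPart (BTemp (ThetaSetting.model p).PiTemp)))
    (h𝔉 : 𝔉.toThetaSubquotientStub = ThetaSubquotient.ofSetting (ThetaSetting.model p) l) :
    IsEmpty (ThetaSubquotientProj 𝔉) ∧ Nonempty (ThetaSubquotientProjGalois 𝔉 fun E => IsGaloisObj E.obj) :=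
  ⟨isEmpty_thetaSubquotientProj_ofSetting_model p l hl 𝔉 h𝔉,
    nonempty_thetaSubquotientProjGalois_ofSetting_model p l 𝔉 h𝔉⟩

/-- Hence at the root model (`l` odd) the forgetful map v1 → v2 is NOT onto up to isomorphism in the crudest sense: the v2 record has an
inhabitant that comes from no v1 record (there is none). [cite: MochizukiEtTh2009, §5 p.327 (PDF p.101)] -/
theorem exists_projGalois_not_in_range_toGalois_ofSetting_model (l : ℕ) (hl : Odd l)
    {C : Type u₁} [CategoryTheory.Category.{v₁} C]
    (𝔉 : ThetaFrobenioid.{0} C (ConnectedPart (BTemp (ThetaSetting.model p).PiTemp)))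
    (h𝔉 : 𝔉.toThetaSubquotientStub = ThetaSubquotient.ofSetting (ThetaSetting.model p) l) :
    ∃ P : ThetaSubquotientProjGalois 𝔉 fun E => IsGaloisObj E.obj,
      ∀ P₁ : ThetaSubquotientProj 𝔉, P₁.toGalois _ ≠ P := by
  obtain ⟨hempty, ⟨P⟩⟩ := isEmpty_proj_and_nonempty_projGalois_ofSetting_model p l hl 𝔉 h𝔉
  exact ⟨P, fun P₁ => (hempty.false P₁).elim⟩

end SettingModel

end Literature.AnabelianGeometry.EtaleTheta

end
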